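import Mathlib
import Literature.NumberTheory.LFunctions.Zhang2022.Section6SegmentSplit
import Literature.NumberTheory.LFunctions.Zhang2022.Section5Lemma51
import Literature.Analysis.SpecialFunctions.GammaStirlingOrder
import HarnessLib

/-!
# Zhang (2022), §6 (6.5), part 2/4: the size of `Z(s,ψ)` — Stirling off the line, and Lemma 5.1
# (5.2) on Lemma 6.1's range `|σ − 1/2| < 2α`

Topic `Literature/NumberTheory/LFunctions/Zhang2022` (Landau–Siegel audit tree; verdict-neutral).
Y. Zhang, *Discrete mean estimates and the Landau–Siegel zero*, arXiv:2211.02515v1 (2022)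
[Zhang2022LandauSiegel] — **an unrefereed manuscript under adjudication**; nothing here asserts or
denies its Theorems 1–2 or anything about Landau–Siegel zeros, and nothing bears on the verdict on
(8.24). Campaign DAG nodes `Z22:(6.5)` / `Z22:Lem6.1.pf` (§6 p. 32, tex L1755–L1781), typed in
`Section6Statements` as `Step6split` / `Step6last`; GAP-LEDGER rows G-d08-1 / G-d08-2.

This file (no new definitions, no facts):
* `norm_vartheta_le_poly`, `norm_Zfac_le_poly` — for a primitive `θ (mod k)`, `−1 ≤ σ′ < 1`, `t′ ≥ 1`:
  `|Z(σ′+it′,θ)| ≤ 64π²k²(1+t′)^{3/2}` (exact form (2.4) `GammaFactor.Zfac_eq`, `|τ| = √k`, and the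
  tree's Stirling bound `GammaStirlingOrder.norm_Gamma_le_exp_of_le_two` for `Γ(1−s)` against
  `|sin(πs/2)| ≤ e^{π t′/2}`) — the "trivial bound … simple estimates" of §6 p. 32 for the horizontal
  sides;
* `norm_Zfac_le_exp_sixteen` — `|Z(s,ψ)| ≤ e¹⁶` on `|σ − 1/2| ≤ 2α`, `|t − 2πt₀| < 𝓛₁ + 2`
  (`GammaFactor.norm_Zfac_le_exp_of_abs_sub_half_le` of `Section5Lemma51`);
* `norm_Zshift_div_le` — **Lemma 5.1 (5.2) on the `2α`-range**: `|(Z(s+iv,ψ) − Z(s,ψ)(Pt₀)^{−iv})/(iv)|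
  ≤ 9e¹⁶𝓛⁻⁶⁸` for `0 < |v| ≤ 𝓛²⁰` (the manuscript applies Lemma 5.1, printed for `|σ − 1/2| ≤ α`,
  on Lemma 6.1's range `< 2α`; the proof — `GammaFactor.norm_Zfac_shift_sub_mul_cpow_div_le` — is
  uniform; G-d08-2, secondary remark).

## References

* Y. Zhang, arXiv:2211.02515v1 (2022), §6 p. 32, (6.3)–(6.5) and the last paragraph of the proof
  of Lemma 6.1; §5 Lemma 5.1; §4 (4.1) (`ω₁`). [cite: Zhang2022LandauSiegel, §6 (6.5)]
* H. L. Montgomery, R. C. Vaughan, *Multiplicative Number Theory I*, CUP 2007, Thm C.1 (Stirling),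
  consumed through the tree's `GammaStirlingOrder` / `Section5VerticalShift`. [cite: montgomery2007, Thm C.1]
-/

noncomputable section

open Complex Real Set MeasureTheory intervalIntegral

namespace Literature.NumberTheory.LFunctions.Zhang2022.Section6Statements

open Skeleton

variable {D : ℕ} (x : Chr D)

/-! ## Stirling size of `Z(s,θ)` off the critical line (for the horizontal sides) -/

omit x in
/-- `|sin z| ≤ e^{|Im z|}`. [folklore] -/
private theorem norm_sin_le_exp_abs_im (z : ℂ) : ‖Complex.sin z‖ ≤ Real.exp |z.im| := by
  have h2 : (2 : ℂ) * Complex.sin z = (cexp (-z * I) - cexp (z * I)) * I := Complex.two_sin z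
  have hn : 2 * ‖Complex.sin z‖ = ‖cexp (-z * I) - cexp (z * I)‖ := by
    have := congrArg (fun u : ℂ => ‖u‖) h2
    simpa [norm_mul, Complex.norm_I] using this
  have h1 : ‖cexp (-z * I)‖ = Real.exp z.im := by
    rw [Complex.norm_exp]; congr 1; simp
  have h3 : ‖cexp (z * I)‖ = Real.exp (-z.im) := by
    rw [Complex.norm_exp]; congr 1; simp
  have h4 : ‖cexp (-z * I) - cexp (z * I)‖ ≤ Real.exp z.im + Real.exp (-z.im) := by
    rw [← h1, ← h3]; exact norm_sub_le _ _
  have h5 : Real.exp z.im ≤ Real.exp |z.im| := Real.exp_le_exp.mpr (le_abs_self _)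
  have h6 : Real.exp (-z.im) ≤ Real.exp |z.im| := Real.exp_le_exp.mpr (neg_le_abs _)
  linarith

omit x in
/-- Stirling size of `ϑ` (2.3): for `−1 ≤ σ′ < 1`, `t′ ≥ 1`, `|ϑ(σ′+it′)| ≤ 32π²(1+t′)^{3/2}`
(`ϑ(s) = 2(2π)^{s−1}Γ(1−s)sin(πs/2)`, the tree's `GammaStirlingOrder.norm_Gamma_le_exp_of_le_two`
and `|sin(πs/2)| ≤ e^{πt′/2}`). [cite: Zhang2022LandauSiegel, §2 (2.3)–(2.5)] -/
theorem norm_vartheta_le_poly {σ' t' : ℝ} (hσ1 : -1 ≤ σ') (hσ2 : σ' < 1) (ht : 1 ≤ t') :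
    ‖GammaFactor.vartheta ((σ' : ℂ) + t' * I)‖ ≤ 32 * π ^ 2 * (1 + t') ^ ((3 : ℝ) / 2) := by
  have ht0 : 0 ≤ t' := by linarith
  have h1s : 1 - ((σ' : ℂ) + t' * I) = ((1 - σ' : ℝ) : ℂ) + ((-t' : ℝ) : ℂ) * I := by
    push_cast; ring
  have hG := Literature.Analysis.SpecialFunctions.norm_Gamma_le_exp_of_le_two
    (x := 1 - σ') (y := -t') (by linarith) (by linarith) (by rw [abs_neg, abs_of_nonneg ht0]; exact ht)
  rw [abs_neg, abs_of_nonneg ht0] at hG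
  have hsin : ‖Complex.sin (π * ((σ' : ℂ) + t' * I) / 2)‖ ≤ Real.exp (π * t' / 2) := by
    refine (norm_sin_le_exp_abs_im _).trans (le_of_eq ?_)
    congr 1
    have : (π * ((σ' : ℂ) + t' * I) / 2).im = π * t' / 2 := by simp
    rw [this, abs_of_nonneg (by positivity)]
  have hpow : ‖(2 * π : ℂ) ^ (((σ' : ℂ) + t' * I) - 1)‖ ≤ 1 := by
    have h2π : (2 * π : ℂ) = ((2 * π : ℝ) : ℂ) := by push_cast; ring
    rw [h2π, Complex.norm_cpow_eq_rpow_re_of_pos (by positivity)]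
    refine Real.rpow_le_one_of_one_le_of_nonpos (by linarith [Real.pi_gt_three]) ?_
    simp; linarith
  unfold GammaFactor.vartheta
  rw [h1s] at *
  calc ‖2 * (2 * π : ℂ) ^ (((σ' : ℂ) + t' * I) - 1) *
          Complex.Gamma (((1 - σ' : ℝ) : ℂ) + ((-t' : ℝ) : ℂ) * I) *
          Complex.sin (π * ((σ' : ℂ) + t' * I) / 2)‖
      = 2 * ‖(2 * π : ℂ) ^ (((σ' : ℂ) + t' * I) - 1)‖ *
          ‖Complex.Gamma (((1 - σ' : ℝ) : ℂ) + ((-t' : ℝ) : ℂ) * I)‖ *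
          ‖Complex.sin (π * ((σ' : ℂ) + t' * I) / 2)‖ := by
        simp only [norm_mul, Complex.norm_ofNat]
    _ ≤ 2 * 1 * (16 * π ^ 2 * (1 + t') ^ ((3 : ℝ) / 2) * Real.exp (-(π * t') / 2)) *
          Real.exp (π * t' / 2) := by
        gcongr
    _ = 32 * π ^ 2 * (1 + t') ^ ((3 : ℝ) / 2) * (Real.exp (-(π * t') / 2) * Real.exp (π * t' / 2)) := by
        ring
    _ = 32 * π ^ 2 * (1 + t') ^ ((3 : ℝ) / 2) := by
        rw [← Real.exp_add, show -(π * t') / 2 + π * t' / 2 = 0 by ring, Real.exp_zero, mul_one]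

omit x in
/-- **Stirling size of `Z(s,θ)` off the critical line**: for a primitive `θ (mod k)`,
`−1 ≤ σ′ < 1`, `t′ ≥ 1`: `|Z(σ′+it′,θ)| ≤ 64π²k²(1+t′)^{3/2}` (exact form (2.4) `GammaFactor.Zfac_eq`,
`|τ(θ)| = √k`, `|k^{−s}| = k^{−σ′} ≤ k`, `|1 + r| ≤ 2`, and `norm_vartheta_le_poly`).
[cite: Zhang2022LandauSiegel, §2 (2.4)] -/
theorem norm_Zfac_le_poly {k : ℕ} [NeZero k] {θ : DirichletCharacter ℂ k} (hθ : θ.IsPrimitive)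
    {σ' t' : ℝ} (hσ1 : -1 ≤ σ') (hσ2 : σ' < 1) (ht : 1 ≤ t') :
    ‖GammaFactor.Zfac θ ((σ' : ℂ) + t' * I)‖ ≤ 64 * π ^ 2 * (k : ℝ) ^ 2 * (1 + t') ^ ((3 : ℝ) / 2) := by
  have him : 0 < (((σ' : ℂ) + t' * I)).im := by simp; linarith
  have him1 : 1 ≤ (((σ' : ℂ) + t' * I)).im := by simp; exact ht
  have hk1 : (1 : ℝ) ≤ k := by exact_mod_cast Nat.one_le_iff_ne_zero.mpr (NeZero.ne k)
  have hk0 : (0 : ℝ) < k := by linarith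
  rw [GammaFactor.Zfac_eq θ him]
  have h1 : ‖θ (-1)‖ ≤ 1 := DirichletCharacter.norm_le_one θ _
  have h2 : ‖GammaFactor.tau θ‖ ≤ k := by
    rw [GammaFactor.norm_tau hθ]
    calc Real.sqrt k ≤ Real.sqrt ((k : ℝ) ^ 2) := Real.sqrt_le_sqrt (by nlinarith)
      _ = k := Real.sqrt_sq hk0.le
  have h3 : ‖(k : ℂ) ^ (-((σ' : ℂ) + t' * I))‖ ≤ k := by
    rw [show (k : ℂ) = ((k : ℝ) : ℂ) by push_cast; ring, Complex.norm_cpow_eq_rpow_re_of_pos hk0]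
    refine Real.rpow_le_self_of_one_le hk1 ?_
    simp; linarith
  have h4 : ‖GammaFactor.vartheta ((σ' : ℂ) + t' * I)‖ ≤ 32 * π ^ 2 * (1 + t') ^ ((3 : ℝ) / 2) :=
    norm_vartheta_le_poly hσ1 hσ2 ht
  have h5 : ‖1 + GammaFactor.corr θ ((σ' : ℂ) + t' * I)‖ ≤ 2 := by
    have hc := GammaFactor.norm_corr_le θ him1
    have he : Real.exp (-π * ((σ' : ℂ) + t' * I).im) ≤ 1 / 3 := by
      have : ((σ' : ℂ) + t' * I).im = t' := by simp
      rw [this]; exact GammaFactor.exp_neg_pi_mul_le ht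
    calc ‖1 + GammaFactor.corr θ ((σ' : ℂ) + t' * I)‖
        ≤ ‖(1 : ℂ)‖ + ‖GammaFactor.corr θ ((σ' : ℂ) + t' * I)‖ := norm_add_le _ _
      _ ≤ 1 + 3 * (1 / 3) := by rw [norm_one]; gcongr; exact hc.trans (by gcongr)
      _ = 2 := by norm_num
  calc ‖θ (-1) * GammaFactor.tau θ * (k : ℂ) ^ (-((σ' : ℂ) + t' * I)) *
          GammaFactor.vartheta ((σ' : ℂ) + t' * I) * (1 + GammaFactor.corr θ ((σ' : ℂ) + t' * I))‖
      = ‖θ (-1)‖ * ‖GammaFactor.tau θ‖ * ‖(k : ℂ) ^ (-((σ' : ℂ) + t' * I))‖ *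
          ‖GammaFactor.vartheta ((σ' : ℂ) + t' * I)‖ *
          ‖1 + GammaFactor.corr θ ((σ' : ℂ) + t' * I)‖ := by simp only [norm_mul]
    _ ≤ 1 * k * k * (32 * π ^ 2 * (1 + t') ^ ((3 : ℝ) / 2)) * 2 := by
        gcongr
    _ = 64 * π ^ 2 * (k : ℝ) ^ 2 * (1 + t') ^ ((3 : ℝ) / 2) := by ring

/-! ## The Lemma 5.1-type bound on `u = 0` for Lemma 6.1's range `|σ − 1/2| < 2α` -/

omit x in
/-- `2π𝓛⁻⁹ ≤ 1/4` for `𝓛 ≥ 3` (so `|σ − 1/2| < 2α` lies inside `|σ − 1/2| ≤ 1/4`).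
[cite: Zhang2022LandauSiegel, §2 (2.10)] -/
theorem two_alpha_le {L : ℝ} (hL : 3 ≤ L) : 2 * (π / L ^ 9) ≤ 1 / 4 := by
  have hL9 : (3 : ℝ) ^ 9 ≤ L ^ 9 := pow_le_pow_left₀ (by norm_num) hL 9
  rw [mul_div_assoc', div_le_iff₀ (by positivity)]
  nlinarith [Real.pi_lt_four]

omit x in
/-- The `v`-range `|v| ≤ 𝓛²⁰` against `t ≥ 5𝓛⁵¹⁹`: `|v| ≤ t/2`, `(2|v|+14)|v|/t ≤ 1` and
`2(2|v|+14)/t ≤ 7𝓛⁻¹¹⁴`. [cite: Zhang2022LandauSiegel, §5 Lemma 5.1] -/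
private theorem aux_v6 {L t v : ℝ} (hL : 3 ≤ L) (ht : 5 * L ^ 519 ≤ t) (hv : |v| ≤ L ^ 20) :
    |v| ≤ t / 2 ∧ (2 * |v| + 14) * |v| / t ≤ 1 ∧ 2 * ((2 * |v| + 14) / t) ≤ 7 * (L ^ 114)⁻¹ := by
  have hL1 : 1 ≤ L := by linarith
  have hL0 : 0 < L := by linarith
  have h20 : (1 : ℝ) ≤ L ^ 20 := one_le_pow₀ hL1
  have h20' : L ^ 20 ≤ L ^ 519 := pow_le_pow_right₀ hL1 (by norm_num)
  have ht0 : 0 < t := by nlinarith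
  have hv0 : 0 ≤ |v| := abs_nonneg v
  have hX0 : 0 < L ^ 114 := by positivity
  have hsq : L ^ 2 ≤ L ^ 479 := pow_le_pow_right₀ hL1 (by norm_num)
  have h479 : (4 : ℝ) ≤ L ^ 479 := by nlinarith
  have h385 : (1 : ℝ) ≤ L ^ 385 := one_le_pow₀ hL1
  refine ⟨by nlinarith, ?_, ?_⟩
  · rw [div_le_one ht0]
    have h1 : (2 * |v| + 14) * |v| ≤ 16 * L ^ 20 * L ^ 20 := by nlinarith
    have h2 : 16 * L ^ 20 * L ^ 20 ≤ 5 * L ^ 519 := by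
      have h3 : L ^ 519 = L ^ 20 * L ^ 20 * L ^ 479 := by rw [← pow_add, ← pow_add]
      rw [h3]; nlinarith [mul_pos (pow_pos hL0 20) (pow_pos hL0 20)]
    linarith
  · have h1 : 2 * ((2 * |v| + 14) / t) ≤ 32 * L ^ 20 / (5 * L ^ 519) := by
      rw [← mul_div_assoc]
      exact div_le_div₀ (by positivity) (by nlinarith) (by positivity) ht
    have h2 : 32 * L ^ 20 / (5 * L ^ 519) ≤ 7 * (L ^ 114)⁻¹ := by
      rw [← div_eq_mul_inv, div_le_div_iff₀ (by positivity) hX0]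
      have h3 : L ^ 519 = L ^ 20 * L ^ 114 * L ^ 385 := by rw [← pow_add, ← pow_add]
      rw [h3]; nlinarith [mul_pos (pow_pos hL0 20) (pow_pos hL0 114)]
    exact h1.trans h2

omit x in
/-- `|log y| ≤ 2|y − 1|` for `y ≥ 1/2`. [folklore] -/
private theorem abs_log_le_two_mul' {y : ℝ} (hy : 1 / 2 ≤ y) : |Real.log y| ≤ 2 * |y - 1| := by
  have hy0 : 0 < y := by linarith
  have h1 : Real.log y ≤ y - 1 := Real.log_le_sub_one_of_pos hy0
  have h2 : 1 - y⁻¹ ≤ Real.log y := Real.one_sub_inv_le_log_of_pos hy0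
  rw [abs_le]
  constructor
  · have h3 : 1 - y⁻¹ = (y - 1) / y := by field_simp
    rw [h3] at h2
    have h4 : -(2 * |y - 1|) ≤ (y - 1) / y := by
      rw [le_div_iff₀ hy0]
      have h5 : -|y - 1| ≤ y - 1 := neg_abs_le _
      nlinarith [abs_nonneg (y - 1)]
    linarith
  · linarith [le_abs_self (y - 1), abs_nonneg (y - 1)]

omit x in
/-- "`pt/2π = Pt₀(1 + O(𝓛⁻⁶⁸))`": `|log(t/2πt₀)| ≤ 𝓛⁻¹¹⁴` on `|t − 2πt₀| < 𝓛₁ + 2`.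
[cite: Zhang2022LandauSiegel, §5 Lemma 5.1 (proof, last sentence)] -/
private theorem aux_logt6 {L t : ℝ} (hL : 3 ≤ L) (ht : |t - 2 * π * L ^ 519| < L ^ 405 + 2) :
    |Real.log (t / (2 * π * L ^ 519))| ≤ (L ^ 114)⁻¹ := by
  have hL1 : 1 ≤ L := by linarith
  have hL0 : 0 < L := by linarith
  have hX0 : 0 < L ^ 114 := by positivity
  have hT0 : 0 < 2 * π * L ^ 519 := by positivity
  have h405 : (3 : ℝ) ≤ L ^ 405 := hL.trans (le_self_pow₀ hL1 (by norm_num))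
  have hu : |t / (2 * π * L ^ 519) - 1| ≤ (L ^ 114)⁻¹ / 3 := by
    rw [show t / (2 * π * L ^ 519) - 1 = (t - 2 * π * L ^ 519) / (2 * π * L ^ 519) by
      field_simp, abs_div, abs_of_pos hT0, div_le_iff₀ hT0]
    have h1 : |t - 2 * π * L ^ 519| ≤ 2 * L ^ 405 := by linarith [ht.le]
    have h2 : 2 * L ^ 405 ≤ (L ^ 114)⁻¹ / 3 * (2 * π * L ^ 519) := by
      have h3 : L ^ 519 = L ^ 405 * L ^ 114 := by rw [← pow_add]
      have h4 : (L ^ 114)⁻¹ / 3 * (2 * π * (L ^ 405 * L ^ 114)) = 2 * π / 3 * L ^ 405 := by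
        field_simp
      rw [h3, h4]
      nlinarith [pow_pos hL0 405, Real.pi_gt_three]
    exact h1.trans h2
  have hy : 1 / 2 ≤ t / (2 * π * L ^ 519) := by
    have h1 : (L ^ 114)⁻¹ ≤ 1 := inv_le_one_of_one_le₀ (one_le_pow₀ hL1)
    have h2 := (abs_le.mp hu).1
    linarith
  calc |Real.log (t / (2 * π * L ^ 519))| ≤ 2 * |t / (2 * π * L ^ 519) - 1| :=
        abs_log_le_two_mul' hy
    _ ≤ 2 * ((L ^ 114)⁻¹ / 3) := by gcongr
    _ ≤ (L ^ 114)⁻¹ := by nlinarith [inv_pos.mpr hX0]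

omit x in
/-- `0 ≤ log(kt/2π) ≤ 2𝓛⁹` for `1 ≤ k`, `log k ≤ 𝓛⁹ + 𝓛 + 1`, `5𝓛⁵¹⁹ ≤ t ≤ 8𝓛⁵¹⁹`.
[cite: Zhang2022LandauSiegel, §5 Lemma 5.1 (proof)] -/
private theorem aux_logk6 {L t K : ℝ} (hL : 3 ≤ L) (ht5 : 5 * L ^ 519 ≤ t) (ht8 : t ≤ 8 * L ^ 519)
    (hK1 : 1 ≤ K) (hK : Real.log K ≤ L ^ 9 + L + 1) :
    |Real.log (K * t / (2 * π))| ≤ 2 * L ^ 9 := by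
  have hL1 : 1 ≤ L := by linarith
  have hL0 : 0 < L := by linarith
  have hK0 : 0 < K := by linarith
  have h519' : (3 : ℝ) ≤ L ^ 519 := hL.trans (le_self_pow₀ hL1 (by norm_num))
  have ht0 : 0 < t := by linarith
  have hy1 : 1 ≤ K * t / (2 * π) := by
    rw [le_div_iff₀ (by positivity), one_mul]
    have hKt : t ≤ K * t := le_mul_of_one_le_left ht0.le hK1
    linarith [Real.pi_lt_four]
  rw [abs_of_nonneg (Real.log_nonneg hy1), mul_div_assoc,
    Real.log_mul hK0.ne' (by positivity)]
  have hlogt : Real.log (t / (2 * π)) ≤ 3 + 519 * L := by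
    have h1 : t / (2 * π) ≤ 8 * L ^ 519 := by
      rw [div_le_iff₀ (by positivity)]; nlinarith [Real.pi_gt_three, pow_pos hL0 519]
    have h2 : 0 < t / (2 * π) := by positivity
    calc Real.log (t / (2 * π)) ≤ Real.log (8 * L ^ 519) := Real.log_le_log h2 h1
      _ = Real.log 8 + 519 * Real.log L := by
          rw [Real.log_mul (by norm_num) (by positivity), Real.log_pow]; push_cast; ring
      _ ≤ 3 + 519 * L := by
          have h8 : Real.log 8 ≤ 3 := by
            rw [show (8 : ℝ) = 2 ^ 3 by norm_num, Real.log_pow]; push_cast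
            linarith [Real.log_two_lt_d9]
          have hLL : Real.log L ≤ L := (Real.log_le_sub_one_of_pos hL0).trans (by linarith)
          linarith
  have h9 : 520 * L + 4 ≤ L ^ 9 := by
    have h1 : L ^ 9 = L * L ^ 8 := by ring
    have h8 : (3 : ℝ) ^ 8 ≤ L ^ 8 := pow_le_pow_left₀ (by norm_num) hL 8
    nlinarith
  linarith

/-- The window `p ∼ P` in logarithms: `log p ≤ 𝓛⁹ + 𝓛 + 1` and `0 ≤ log(p/P) ≤ 𝓛⁻⁶⁸` (`𝓛 ≥ 3`).
[cite: Zhang2022LandauSiegel, §2 p.4] -/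
theorem log_window (hL : 3 ≤ ell D) :
    bigP D < x.p ∧ Real.log (x.p : ℝ) ≤ ell D ^ 9 + ell D + 1 ∧
      |Real.log ((x.p : ℝ) / bigP D)| ≤ (ell D ^ 68)⁻¹ := by
  have hL1 : 1 ≤ ell D := by linarith
  have hm := x.mem
  rw [primeWindow, Finset.mem_filter, Finset.mem_Ioo] at hm
  have hP0 : 0 < bigP D := Real.exp_pos _
  have hPp : bigP D < x.p := (Nat.floor_lt hP0.le).mp hm.1.1
  have hpP : (x.p : ℝ) < bigP D * (1 + (ell D ^ 68)⁻¹) := Nat.lt_ceil.mp hm.1.2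
  have hlogP : Real.log (bigP D) = ell D ^ 9 := by rw [bigP, Real.log_exp]
  have hp0 : (0 : ℝ) < x.p := hP0.trans hPp
  have h68 : (ell D ^ 68)⁻¹ ≤ 1 := inv_le_one_of_one_le₀ (one_le_pow₀ hL1)
  refine ⟨hPp, ?_, ?_⟩
  · have h4 : (x.p : ℝ) ≤ bigP D * 2 :=
      hpP.le.trans (mul_le_mul_of_nonneg_left (by linarith) hP0.le)
    calc Real.log (x.p : ℝ) ≤ Real.log (bigP D * 2) := Real.log_le_log hp0 h4
      _ = ell D ^ 9 + Real.log 2 := by rw [Real.log_mul hP0.ne' two_ne_zero, hlogP]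
      _ ≤ ell D ^ 9 + ell D + 1 := by linarith [Real.log_two_lt_d9]
  · have h1 : 1 ≤ (x.p : ℝ) / bigP D := by rw [le_div_iff₀ hP0, one_mul]; exact hPp.le
    have h2 : (x.p : ℝ) / bigP D ≤ 1 + (ell D ^ 68)⁻¹ := by rw [div_le_iff₀ hP0]; linarith
    rw [abs_of_nonneg (Real.log_nonneg h1)]
    calc Real.log ((x.p : ℝ) / bigP D) ≤ (x.p : ℝ) / bigP D - 1 :=
          Real.log_le_sub_one_of_pos (by positivity)
      _ ≤ (ell D ^ 68)⁻¹ := by linarith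

/-- **`|Z(s,ψ)| ≤ e¹⁶` on Lemma 6.1's range** `|σ − 1/2| ≤ 2α`, `|t − 2πt₀| < 𝓛₁ + 2` (`ψ ∈ Ψ`,
`𝓛 ≥ 3`): `|Z(1/2+it)| = 1` and the Stirling bound for `Z′/Z` integrated horizontally
(`GammaFactor.norm_Zfac_le_exp_of_abs_sub_half_le`), `2α(|log(pt/2π)| + 14/t) ≤ 4π + 1 ≤ 16`.
[cite: Zhang2022LandauSiegel, §5 Lemma 5.1 (proof); §6 Lemma 6.1] -/
theorem norm_Zfac_le_exp_sixteen (hL : 3 ≤ ell D) {σ t : ℝ} (hσ : |σ - 1 / 2| ≤ 2 * alpha D)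
    (ht : |t - 2 * π * ell D ^ 519| < ell D ^ 405 + 2) :
    ‖GammaFactor.Zfac x.ψ ((σ : ℂ) + t * I)‖ ≤ Real.exp 16 := by
  have hL1 : 1 ≤ ell D := by linarith
  have hL0 : 0 < ell D := by linarith
  have hα : alpha D = π / ell D ^ 9 := by rw [alpha, bigP, Real.log_exp]
  obtain ⟨ht5, ht8⟩ := t_range hL ht
  have ht0 : 0 < t := by nlinarith [pow_pos hL0 519]
  have ht4 : 4 ≤ t := by nlinarith [one_le_pow₀ (M₀ := ℝ) hL1 (n := 519)]
  have hσ4 : |σ - 1 / 2| ≤ 1 / 4 := hσ.trans (by rw [hα]; exact two_alpha_le hL)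
  obtain ⟨hPp, hlogK, -⟩ := log_window x hL
  have hp1 : (1 : ℝ) ≤ x.p := by exact_mod_cast x.prime.one_lt.le
  have h14 : 14 / t ≤ 4 := by rw [div_le_iff₀ ht0]; linarith
  refine (GammaFactor.norm_Zfac_le_exp_of_abs_sub_half_le x.prim hσ4 ht4).trans
    (Real.exp_le_exp.mpr ?_)
  have hX := aux_logk6 hL ht5 ht8 hp1 hlogK
  have hL9 : (3 : ℝ) ^ 9 ≤ ell D ^ 9 := pow_le_pow_left₀ (by norm_num) hL 9
  have h9 : 0 < ell D ^ 9 := by positivity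
  have ha : |σ - 1 / 2| ≤ 2 * (π / ell D ^ 9) := by rw [← hα]; exact hσ
  have h1 : |σ - 1 / 2| * (|Real.log ((x.p : ℝ) * t / (2 * π))| + 14 / t)
      ≤ 2 * (π / ell D ^ 9) * (2 * ell D ^ 9 + 4) :=
    mul_le_mul ha (by linarith) (by positivity) (by positivity)
  have h2 : 2 * (π / ell D ^ 9) * (2 * ell D ^ 9 + 4) = 4 * π + 8 * π / ell D ^ 9 := by
    field_simp; ring
  have h3 : 8 * π / ell D ^ 9 ≤ 1 := by rw [div_le_iff₀ h9]; nlinarith [Real.pi_lt_four]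
  linarith [Real.pi_lt_d2]

/-- **Lemma 5.1 (5.2) on Lemma 6.1's range** (the manuscript applies Lemma 5.1, printed for
`|σ − 1/2| ≤ α`, with `|σ − 1/2| < 2α`; the proof is uniform): for `ψ ∈ Ψ`, `|σ − 1/2| ≤ 2α`,
`|t − 2πt₀| < 𝓛₁ + 2`, `0 < |v| ≤ 𝓛²⁰` and `𝓛 ≥ 3`,
`|(Z(s+iv,ψ) − Z(s,ψ)(Pt₀)^{−iv})/(iv)| ≤ 9e¹⁶𝓛⁻⁶⁸`.
[cite: Zhang2022LandauSiegel, §5 Lemma 5.1 (5.2); §6 p.32, tex L1777] -/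
theorem norm_Zshift_div_le (hL : 3 ≤ ell D) {σ t v : ℝ} (hσ : |σ - 1 / 2| ≤ 2 * alpha D)
    (ht : |t - 2 * π * ell D ^ 519| < ell D ^ 405 + 2) (hv0 : v ≠ 0) (hv : |v| ≤ ell D ^ 20) :
    ‖(GammaFactor.Zfac x.ψ ((σ : ℂ) + t * I + v * I) -
        GammaFactor.Zfac x.ψ ((σ : ℂ) + t * I) * ((bigP D * t0 D : ℝ) : ℂ) ^ (-(v * I))) /
        (v * I)‖ ≤ 9 * Real.exp 16 * (ell D ^ 68)⁻¹ := by
  rw [t0]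
  have hL1 : 1 ≤ ell D := by linarith
  have hL0 : 0 < ell D := by linarith
  have hα : alpha D = π / ell D ^ 9 := by rw [alpha, bigP, Real.log_exp]
  obtain ⟨ht5, ht8⟩ := t_range hL ht
  have ht0 : 0 < t := by nlinarith [pow_pos hL0 519]
  have ht4 : 4 ≤ t := by nlinarith [one_le_pow₀ (M₀ := ℝ) hL1 (n := 519)]
  have hσ4 : |σ - 1 / 2| ≤ 1 / 4 := hσ.trans (by rw [hα]; exact two_alpha_le hL)
  obtain ⟨hσa, hσb⟩ := abs_le.mp hσ4
  have hσ0 : 0 < σ := by linarith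
  have hσ1 : σ ≤ 1 := by linarith
  obtain ⟨hv2, hsmall, hmainErr⟩ := aux_v6 hL ht5 hv
  have hlogt : |Real.log (t / (2 * π * ell D ^ 519))| ≤ (ell D ^ 114)⁻¹ := aux_logt6 hL ht
  obtain ⟨hPp, -, hlogp⟩ := log_window x hL
  have hP0 : 0 < bigP D := Real.exp_pos _
  have hp0 : (0 : ℝ) < x.p := hP0.trans hPp
  have hM : ‖GammaFactor.Zfac x.ψ ((σ : ℂ) + t * I)‖ ≤ Real.exp 16 :=
    norm_Zfac_le_exp_sixteen x hL hσ ht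
  -- the log comparison `|log(pt/2π) − log(Pt₀)| ≤ 2𝓛⁻⁶⁸`
  have hR : 0 < bigP D * ell D ^ 519 := by positivity
  have hkt : 0 < (x.p : ℝ) * t / (2 * π) := by positivity
  have hqt : 0 < t / (2 * π * ell D ^ 519) := by positivity
  have hqp : 0 < (x.p : ℝ) / bigP D := by positivity
  have hq : (x.p : ℝ) * t / (2 * π) / (bigP D * ell D ^ 519) =
      (x.p : ℝ) / bigP D * (t / (2 * π * ell D ^ 519)) := by
    field_simp
  have h68 : (ell D ^ 114)⁻¹ ≤ (ell D ^ 68)⁻¹ :=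
    inv_anti₀ (by positivity) (pow_le_pow_right₀ hL1 (by norm_num))
  have hε : |Real.log ((x.p : ℝ) * t / (2 * π)) - Real.log (bigP D * ell D ^ 519)|
      ≤ 2 * (ell D ^ 68)⁻¹ := by
    rw [← Real.log_div hkt.ne' hR.ne', hq, Real.log_mul hqp.ne' hqt.ne']
    exact ((abs_add_le _ _).trans (add_le_add hlogp hlogt)).trans (by linarith)
  have h := GammaFactor.norm_Zfac_shift_sub_mul_cpow_div_le x.prim hσ0 hσ1 ht4 hv0 hv2 hsmall
    hM hR hε
  refine h.trans ?_
  have hE : 0 < Real.exp 16 := Real.exp_pos _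
  have hb : 2 * ((2 * |v| + 14) / t) + 2 * (ell D ^ 68)⁻¹ ≤ 9 * (ell D ^ 68)⁻¹ := by linarith
  calc Real.exp 16 * (2 * ((2 * |v| + 14) / t) + 2 * (ell D ^ 68)⁻¹)
      ≤ Real.exp 16 * (9 * (ell D ^ 68)⁻¹) := mul_le_mul_of_nonneg_left hb hE.le
    _ = 9 * Real.exp 16 * (ell D ^ 68)⁻¹ := by ring

end Literature.NumberTheory.LFunctions.Zhang2022.Section6Statements
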